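import Summits.MatrixMultiplication.MatrixMultiplication.Theses.SaturationLadder
import Summits.MatrixMultiplication.MatrixMultiplication.Theorems.SaturationLadderRateCalibration
import Summits.MatrixMultiplication.MatrixMultiplication.Theorems.FarEdgeDescentLadderBridge
import Summits.MatrixMultiplication.MatrixMultiplication.Theorems.FarEdgeDescentCornerFold
import HarnessLib

/-!
# SaturationLadder — the onset continuum: the residual `SquareFromTwo` (stmt-MatrixMultiplication-29475)
# graded along the REAL length axis; one invariant decides every piece of the onset ladder

Cell `decomp-mm`, lens 1 «grading / quantitative ladder», generation 17; cut of record UNCHANGED (`closes :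
SubexpSaturation → SubexpToPoly → PolyToFinite → TailDescentTwo → SquareFromTwo → ω = 2`).  Write
`E_a :⟺ ω(1,a,1) = a + 1` (REAL `a ≥ 1`; `E_1` is `ω = 2`, `E_2` the residual's hypothesis).  Def-free, no sorry:
§1 `E_a` is up-closed and closed in `a`, `E_a ⟺ ∀ t ∈ [0,1), ω(1,t,a) ≤ 1 + a` (far tightness at length `a`
   IS the uniform bound `r(t) ≤ a` on this route's ladder), and the ONSET NUMBER `a₀ = inf {a ≥ 1 : E_a}` is
   attained: the far-tight lengths form the closed ray `[a₀, ∞)` (`far_sInf`, `far_iff_sInf_le`).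
§2 The limit rung is free — `(∀ a > 1, E_a) → ω = 2` by monotonicity alone (`summit_of_forall_far`); the
   law-price of `E_a` is `ω ≤ 3(a+1)/(a+2) = 2 + (a−1)/(a+2)` (`omega_le_of_far`).
§3 The residual is a ladder with NO bottom rung: for ANY `2 = a₀ > a₁ > … ↓ 1`, `SquareFromTwo ⟺
   ⋀ₙ (E_{aₙ} → E_{aₙ₊₁})` (`squareFromTwo_iff_rungs`, dyadic instance), `⟺ (E₂ → E_a) ∧ (E_a → ω = 2)` for
   each `1 < a ≤ 2` (`squareFromTwo_iff_split`); truncations `⋀_{n<K} rungₙ ∧ (E_{a_K} → ω = 2)` whose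
   residual hypothesis already pays `ω ≤ 2 + 1/(3·2^K+1)`; `FiniteToSquare ⟺ TailDescentTwo ∧ SquareFromTwo`
   (gen-7 split, landed); `ω = 2 ⟺ FiniteSaturation ∧ ⋀_{k≥2}(E_{k+1} → E_k) ∧ ⋀ₙ(E_{1+2^{-n}} → E_{1+2^{-n-1}})`.
§4 Junction with lens 2: each dyadic rung is ONE point-instance `m = 1 + 2^{-(n+1)}` of
   `AnchoredLogConvexity`, so the law at countably many points carries `SquareFromTwo`
   (`squareFromTwo_of_alcDyadicPoints`; the landed `squareFromTwo_of_alcWindow` asks the window `(1, 3/2]`).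
§5 ONE INVARIANT: `ω = 2 ⟺ FiniteSaturation ∧ a₀ = 1`; `TailDescentTwo ⟺ (FiniteSaturation → a₀ ≤ 2)`;
   `SquareFromTwo ⟺ (FiniteSaturation → a₀ = 1 ∨ a₀ > 2)`; a rung `E_b → E_c` `⟺ a₀ ∉ (c, b]`: the residual
   is `a₀ ∉ (1,2]` and every finite set of rungs with feet `> 1` leaves a residual of the same kind (no atom;
   stmt-29475 stays the leaf; world certificates in HOME kernel `decomp-mm-lens-1/gen17/TightCone-g17.lean`).
Up-closure, padding, `ω = 2 ⟹ E_a` and the symmetrisation price are CITED from lens 2 / the lineage.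
[cite: LottiRomani1983, §1–§2 (p. 173–174)] [cite: HuangPan1998, §2 eq. (2.5)–(2.8) (p. 261–262)]
-/

set_option linter.dupNamespace false

noncomputable section

namespace Summit.MatrixMultiplication.MatrixMultiplication.Theorems.SaturationLadderOnsetContinuum

open Literature.Computability.AlgebraicComplexity
open Summit.MatrixMultiplication.MatrixMultiplication.Theses.SaturationLadder
  (TailDescentTwo SquareFromTwo FiniteToSquare FiniteSaturation)
open SaturationLadderRateCalibration (farExcess_le_of_tight)
open FarEdgeDescentLadderBridge (saturated_of_mm)
open FarEdgeDescentCornerZeroSet (sat_region_mono)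
open FarEdgeDescentCornerFold (omega_le_tight)

/-! ## §1 Far tightness `E_a : ω(1,a,1) = a + 1` along the real axis -/

/-- `E_a` is the inequality `ω(1,a,1) ≤ a + 1` (information bound). [cite: LottiRomani1983, §2 (p. 174)] -/
theorem far_iff_le (a : ℝ) : omegaRect ℂ 1 a 1 = a + 1 ↔ omegaRect ℂ 1 a 1 ≤ a + 1 :=
  ⟨le_of_eq, fun h => le_antisymm h (add_one_le_omegaRect_one_mid_one ℂ a)⟩

/-- `E_1 ⟺ ω = 2`. [cite: HuangPan1998, §2 (p. 262)] -/
theorem far_one_iff : omegaRect ℂ 1 1 1 = 1 + 1 ↔ _root_.MatrixMultiplication := by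
  rw [_root_.MatrixMultiplication_iff, omegaRect_one_one_one]; norm_num

/-- **Up-closure in the real length**: `E_a → E_b` for `0 ≤ a ≤ b` (pad the middle factor; lens 2's
`FarEdgeDescentCornerZeroSet.sat_region_mono`, cited). [cite: LottiRomani1983, §1 (p. 173)] -/
theorem far_mono {a b : ℝ} (ha : 0 ≤ a) (hab : a ≤ b) (h : omegaRect ℂ 1 a 1 = a + 1) :
    omegaRect ℂ 1 b 1 = b + 1 :=
  sat_region_mono ha zero_le_one hab le_rfl h

/-- **`E_a` makes every thin shape tight at length `a`**: `ω(1,t,a) ≤ 1 + a` for `0 ≤ t ≤ 1` (scale by `t`,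
pad, transpose). [cite: LottiRomani1983, §1 (p. 173)] -/
theorem thin_of_far {a t : ℝ} (ha : 0 ≤ a) (ht0 : 0 ≤ t) (ht1 : t ≤ 1)
    (h : omegaRect ℂ 1 a 1 = a + 1) : omegaRect ℂ 1 t a ≤ 1 + a := by
  have h1 : omegaRect ℂ 1 a t = a + 1 := sat_region_mono ha ht0 le_rfl ht1 h
  rw [omegaRect_swap₂₃ ℂ 1 t a, h1, add_comm]

/-- **`E_a` ⟺ the saturation length is at most `a` at EVERY thin exponent** (`a ≥ 0`):
`ω(1,a,1) = a + 1 ⟺ ∀ t ∈ [0,1), ω(1,t,a) ≤ 1 + a` — far tightness at the real length `a` is exactly the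
uniform bound `r(t) ≤ a` on this route's ladder (`←`: the far excess is `≤ 1 − t` for every `t < 1`, the
lineage's `farExcess_le_of_tight`, cited; let `t ↑ 1`); at `a = 1` both sides say `ω = 2`.
[cite: LottiRomani1983, §1 (p. 173)] [cite: HuangPan1998, §2 eq. (2.8) (p. 262)] -/
theorem far_iff_forall_thin {a : ℝ} (ha : 0 ≤ a) :
    omegaRect ℂ 1 a 1 = a + 1 ↔ ∀ t : ℝ, 0 ≤ t → t < 1 → omegaRect ℂ 1 t a ≤ 1 + a := by
  refine ⟨fun h _ ht0 ht1 => thin_of_far ha ht0 ht1.le h, fun h => ?_⟩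
  rw [far_iff_le]
  refine le_of_forall_pos_le_add fun ε hε => ?_
  have ht1 : max 0 (1 - ε) < 1 := max_lt one_pos (by linarith)
  have hex := farExcess_le_of_tight ht1.le (h _ (le_max_left _ _) ht1)
  linarith [le_max_right 0 (1 - ε)]

/-- The far-tight real lengths form a closed set. [cite: ChristandlLeGallLysikovZuiddam2025, Rem. 3.13] -/
theorem isClosed_far : IsClosed {a : ℝ | omegaRect ℂ 1 a 1 = a + 1} :=
  isClosed_eq (continuous_omegaRect_one_mid_one ℂ) (continuous_id.add continuous_const)

/-- **The onset number is attained**: if some real `a ≥ 1` is far-tight then, with `T = {a ≥ 1 : E_a}`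
and `a₀ = inf T`, `1 ≤ a₀` and `E_{a₀}` (`T` closed, non-empty, bounded below). [cite: LottiRomani1983, §1 (p. 173)] -/
theorem far_sInf (hT : ∃ a : ℝ, 1 ≤ a ∧ omegaRect ℂ 1 a 1 = a + 1) :
    1 ≤ sInf {a : ℝ | 1 ≤ a ∧ omegaRect ℂ 1 a 1 = a + 1} ∧
      omegaRect ℂ 1 (sInf {a : ℝ | 1 ≤ a ∧ omegaRect ℂ 1 a 1 = a + 1}) 1 =
        sInf {a : ℝ | 1 ≤ a ∧ omegaRect ℂ 1 a 1 = a + 1} + 1 := by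
  have hc : IsClosed {a : ℝ | 1 ≤ a ∧ omegaRect ℂ 1 a 1 = a + 1} := isClosed_Ici.inter isClosed_far
  exact hc.csInf_mem hT ⟨1, fun a ha => ha.1⟩

/-- **The far-tight lengths form the closed ray `[a₀, ∞)`**: with `T ≠ ∅` as above and `b ≥ 1`,
`E_b ⟺ a₀ ≤ b`. [cite: LottiRomani1983, §1 (p. 173)] -/
theorem far_iff_sInf_le (hT : ∃ a : ℝ, 1 ≤ a ∧ omegaRect ℂ 1 a 1 = a + 1) {b : ℝ} (hb : 1 ≤ b) :
    omegaRect ℂ 1 b 1 = b + 1 ↔ sInf {a : ℝ | 1 ≤ a ∧ omegaRect ℂ 1 a 1 = a + 1} ≤ b := by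
  refine ⟨fun h => csInf_le ⟨1, fun a ha => ha.1⟩ ⟨hb, h⟩, fun h => ?_⟩
  obtain ⟨h1, hE⟩ := far_sInf hT
  exact far_mono (by linarith) h hE

/-- `FiniteSaturation ⟺ some REAL length a ≥ 1 is far-tight` (round a real witness up to an integer
`k ≥ 2`). [cite: LottiRomani1983, §2 (p. 174)] -/
theorem finiteSaturation_iff_real :
    FiniteSaturation ↔ ∃ a : ℝ, 1 ≤ a ∧ omegaRect ℂ 1 a 1 = a + 1 := by
  constructor
  · rintro ⟨k, hk, hE⟩
    exact ⟨k, by exact_mod_cast (by omega : 1 ≤ k), hE⟩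
  · rintro ⟨a, ha, hE⟩
    obtain ⟨k, hk⟩ := exists_nat_ge (max 2 a)
    exact ⟨k, by exact_mod_cast (le_max_left (2 : ℝ) a).trans hk,
      far_mono (by linarith) ((le_max_right (2 : ℝ) a).trans hk) hE⟩

/-! ## §2 Prices, and the free limit rung -/

/-- **ω-price of `E_a`** (`a ≥ 0`): `ω ≤ 3(a+1)/(a+2) = 2 + (a−1)/(a+2)` — symmetrise the tight shape
`(1,1,a)` (`FarEdgeDescentCornerFold.omega_le_tight`, cited); sharp among the shape laws (the lineage's
lawful pencil world `odv((a+1)/(a+2))` has `E_a` and `ω = 3(a+1)/(a+2)`). [cite: Blaser2013, Theorem 5.9] -/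
theorem omega_le_of_far {a : ℝ} (ha : 0 ≤ a) (h : omegaRect ℂ 1 a 1 = a + 1) :
    omega ℂ ≤ 3 * (a + 1) / (a + 2) := by
  have h1 := omega_le_tight zero_le_one ha (thin_of_far ha zero_le_one le_rfl h)
  rwa [show (1 : ℝ) + 1 + a = a + 2 by ring, show (1 : ℝ) + a = a + 1 by ring] at h1

/-- `E_a ⟹ ω ≤ a + 1` (`a ≥ 1`; monotonicity `ω = ω(1,1,1) ≤ ω(1,a,1)` alone). [cite: LeGall2012, §1] -/
theorem omega_le_add_one_of_far {a : ℝ} (ha : 1 ≤ a) (h : omegaRect ℂ 1 a 1 = a + 1) :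
    omega ℂ ≤ a + 1 := by
  have h1 := omegaRect_one_mid_one_mono ℂ ha
  rwa [omegaRect_one_one_one, h] at h1

/-- **The limit rung is free**: if EVERY real length `a > 1` is far-tight then `ω = 2` (`ω ≤ a + 1` for all
`a > 1`; monotonicity only — the onset ladder closes at the square by itself). [cite: HuangPan1998, §2 eq. (2.8)] -/
theorem summit_of_forall_far (h : ∀ a : ℝ, 1 < a → omegaRect ℂ 1 a 1 = a + 1) :
    _root_.MatrixMultiplication := by
  rw [_root_.MatrixMultiplication_iff]
  have hge : 2 ≤ omega ℂ := by
    have h2 := two_le_omegaRect_one_one ℂ (1 : ℝ)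
    rwa [omegaRect_one_one_one] at h2
  refine le_antisymm (le_of_forall_pos_le_add fun ε hε => ?_) hge
  have := omega_le_add_one_of_far (a := 1 + ε) (by linarith) (h (1 + ε) (by linarith))
  linarith

/-- **`ω = 2` ⟺ every real length `a > 1` is far-tight** (`→`: Huang–Pan's sandwich, lens 2's
`FarEdgeDescentLadderBridge.saturated_of_mm`, cited). [cite: HuangPan1998, §2 eq. (2.5)–(2.8) (p. 261–262)] -/
theorem summit_iff_forall_far :
    _root_.MatrixMultiplication ↔ ∀ a : ℝ, 1 < a → omegaRect ℂ 1 a 1 = a + 1 :=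
  ⟨fun h _ ha => saturated_of_mm h ha.le, summit_of_forall_far⟩

/-- **`ω = 2` ⟺ far-tight lengths accumulate at `1`**: for every `ε > 0` some `a ∈ (1, 1+ε)` has
`ω(1,a,1) = a + 1` (up-closure does the rest). [cite: HuangPan1998, §2 eq. (2.5)–(2.8) (p. 261–262)] -/
theorem summit_iff_far_near_one :
    _root_.MatrixMultiplication ↔
      ∀ ε : ℝ, 0 < ε → ∃ a : ℝ, 1 < a ∧ a < 1 + ε ∧ omegaRect ℂ 1 a 1 = a + 1 := by
  refine ⟨fun h ε hε => ⟨1 + ε / 2, by linarith, by linarith, saturated_of_mm h (by linarith)⟩,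
    fun h => summit_of_forall_far fun b hb => ?_⟩
  obtain ⟨a, ha1, hab, hE⟩ := h (b - 1) (by linarith)
  exact far_mono (by linarith) (by linarith) hE

/-! ## §3 The residual `SquareFromTwo` is a ladder with no bottom rung -/

/-- **The residual along the real axis**: `SquareFromTwo ⟺ (E₂ → E_a for every real a > 1)`.
[cite: HuangPan1998, §2 eq. (2.8) (p. 262)] -/
theorem squareFromTwo_iff_realDescent :
    SquareFromTwo ↔ (omegaRect ℂ 1 2 1 = 3 → ∀ a : ℝ, 1 < a → omegaRect ℂ 1 a 1 = a + 1) :=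
  ⟨fun h hE _ ha => saturated_of_mm (h hE) ha.le, fun h hE => summit_of_forall_far (h hE)⟩

/-- `E_a` with `1 ≤ a ≤ 2` gives the residual's hypothesis `ω(1,2,1) = 3`. -/
theorem farTwo_of_far {a : ℝ} (ha1 : 1 ≤ a) (ha2 : a ≤ 2) (h : omegaRect ℂ 1 a 1 = a + 1) :
    omegaRect ℂ 1 2 1 = 3 := by
  rw [far_mono (by linarith) ha2 h]; norm_num

/-- **Exact split at any real length `1 < a ≤ 2`**: `SquareFromTwo ⟺ (E₂ → E_a) ∧ (E_a → ω = 2)` — both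
halves follow from `ω = 2`; the second is the residual one rung lower, law-price `(a−1)/(a+2) < 1/4`.
[cite: HuangPan1998, §2 eq. (2.8) (p. 262)] -/
theorem squareFromTwo_iff_split {a : ℝ} (ha1 : 1 < a) (ha2 : a ≤ 2) :
    SquareFromTwo ↔
      (omegaRect ℂ 1 2 1 = 3 → omegaRect ℂ 1 a 1 = a + 1) ∧
        (omegaRect ℂ 1 a 1 = a + 1 → _root_.MatrixMultiplication) :=
  ⟨fun h => ⟨fun hE => saturated_of_mm (h hE) ha1.le, fun hE => h (farTwo_of_far ha1.le ha2 hE)⟩,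
    fun ⟨h₁, h₂⟩ hE => h₂ (h₁ hE)⟩

/-- **The residual is a ladder with no bottom rung**: for ANY lengths `2 = a₀, a₁, … ∈ (1, 2]` reaching
down to `1` (`∀ b > 1, ∃ n, aₙ ≤ b`), `SquareFromTwo ⟺ ⋀ₙ (E_{aₙ} → E_{aₙ₊₁})`. [cite: HuangPan1998, §2 eq. (2.8)] -/
theorem squareFromTwo_iff_rungs {a : ℕ → ℝ} (h0 : a 0 = 2) (hgt : ∀ n, 1 < a n) (hle : ∀ n, a n ≤ 2)
    (hcof : ∀ b : ℝ, 1 < b → ∃ n, a n ≤ b) :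
    SquareFromTwo ↔
      ∀ n : ℕ, omegaRect ℂ 1 (a n) 1 = a n + 1 → omegaRect ℂ 1 (a (n + 1)) 1 = a (n + 1) + 1 := by
  constructor
  · intro h n hn
    exact saturated_of_mm (h (farTwo_of_far (hgt n).le (hle n) hn)) (hgt (n + 1)).le
  · intro h hE
    have hall : ∀ n, omegaRect ℂ 1 (a n) 1 = a n + 1 := by
      intro n
      induction n with
      | zero => rw [h0, hE]; norm_num
      | succ n ih => exact h n ih
    refine summit_of_forall_far fun b hb => ?_
    obtain ⟨n, hn⟩ := hcof b hb
    exact far_mono (by linarith [hgt n]) hn (hall n)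

/-- **Dyadic rungs**: `SquareFromTwo ⟺ ⋀ₙ (E_{1+2^{-n}} → E_{1+2^{-n-1}})`. [cite: HuangPan1998, §2 eq. (2.8)] -/
theorem squareFromTwo_iff_dyadicRungs :
    SquareFromTwo ↔ ∀ n : ℕ,
      omegaRect ℂ 1 (1 + 1 / 2 ^ n) 1 = (1 + 1 / 2 ^ n) + 1 →
        omegaRect ℂ 1 (1 + 1 / 2 ^ (n + 1)) 1 = (1 + 1 / 2 ^ (n + 1)) + 1 :=
  squareFromTwo_iff_rungs (a := fun n : ℕ => (1 : ℝ) + 1 / 2 ^ n) (by norm_num)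
    (fun n => lt_add_of_pos_right _ (by positivity))
    (fun n => by
      have : (1 : ℝ) / 2 ^ n ≤ 1 := (div_le_one (by positivity)).2 (one_le_pow₀ (by norm_num))
      show (1 : ℝ) + 1 / 2 ^ n ≤ 2
      linarith)
    (fun b hb => by
      obtain ⟨n, hn⟩ := exists_pow_lt_of_lt_one (by linarith : 0 < b - 1) (by norm_num : (1 / 2 : ℝ) < 1)
      rw [one_div_pow] at hn
      exact ⟨n, by show (1 : ℝ) + 1 / 2 ^ n ≤ b; linarith⟩)

/-- **`FiniteToSquare ⟺ TailDescentTwo ∧ SquareFromTwo`** (the gen-7 split of aside stmt-25912 into the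
two bottom items of the cut, landed). [cite: HuangPan1998, §2 eq. (2.8) (p. 262)] -/
theorem finiteToSquare_iff_tail_and_square : FiniteToSquare ↔ TailDescentTwo ∧ SquareFromTwo := by
  constructor
  · intro h
    refine ⟨fun ⟨k, hk, hE⟩ => ?_, fun hE => h ⟨2, le_rfl, by push_cast; rw [hE]; norm_num⟩⟩
    have h2 := saturated_of_mm (h ⟨k, by omega, hE⟩) (x := 2) (by norm_num)
    rw [h2]; norm_num
  · rintro ⟨h₄, h₅⟩ ⟨k, hk, hE⟩
    rcases Nat.lt_or_ge 2 k with hlt | hle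
    · exact h₅ (h₄ ⟨k, hlt, hE⟩)
    · obtain rfl : k = 2 := le_antisymm hle hk
      exact h₅ (by have h3 := hE; push_cast at h3; linarith)

/-- **`ω = 2` as ONE countable ladder along the onset axis**: `FiniteSaturation`, every integer rung
`E_{k+1} → E_k` (`k ≥ 2`) and every dyadic rung `E_{1+2^{-n}} → E_{1+2^{-n-1}}`; each conjunct follows from
`ω = 2`, none is a law (lineage worlds). [cite: LottiRomani1983, §2 (p. 174)] [cite: HuangPan1998, §2 eq. (2.8)] -/
theorem summit_iff_onsetLadder :
    _root_.MatrixMultiplication ↔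
      FiniteSaturation ∧
      (∀ k : ℕ, 2 ≤ k → omegaRect ℂ 1 ((k : ℝ) + 1) 1 = ((k : ℝ) + 1) + 1 →
        omegaRect ℂ 1 k 1 = k + 1) ∧
      (∀ n : ℕ, omegaRect ℂ 1 (1 + 1 / 2 ^ n) 1 = (1 + 1 / 2 ^ n) + 1 →
        omegaRect ℂ 1 (1 + 1 / 2 ^ (n + 1)) 1 = (1 + 1 / 2 ^ (n + 1)) + 1) := by
  constructor
  · intro h
    refine ⟨⟨2, le_rfl, ?_⟩, fun k hk _ => saturated_of_mm h (by exact_mod_cast (by omega : 1 ≤ k)),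
      fun n _ => saturated_of_mm h (le_add_of_nonneg_right (by positivity))⟩
    have h2 := saturated_of_mm h (x := 2) (by norm_num)
    push_cast
    linarith
  · rintro ⟨⟨k, hk, hE⟩, hint, hdy⟩
    have hdesc : ∀ d : ℕ, omegaRect ℂ 1 ((2 + d : ℕ) : ℝ) 1 = ((2 + d : ℕ) : ℝ) + 1 →
        omegaRect ℂ 1 2 1 = 3 := by
      intro d
      induction d with
      | zero => intro h2; push_cast at h2; linarith
      | succ d ih =>
        intro h2
        have e : ((2 + (d + 1) : ℕ) : ℝ) = ((2 + d : ℕ) : ℝ) + 1 := by push_cast; ring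
        exact ih (hint (2 + d) (by omega) (by rwa [e] at h2))
    obtain ⟨d, rfl⟩ : ∃ d, k = 2 + d := ⟨k - 2, by omega⟩
    exact squareFromTwo_iff_dyadicRungs.2 hdy (hdesc d hE)

/-! ## §4 Truncated residuals and their prices -/

/-- **Truncations of the residual**: `SquareFromTwo ⟺ ⋀_{n<K} (E_{aₙ} → E_{aₙ₊₁}) ∧ (E_{a_K} → ω = 2)` for
every `K` — the last conjunct is the residual `K` rungs down, of the same kind. [cite: HuangPan1998, §2 eq. (2.8)] -/
theorem squareFromTwo_iff_truncation {a : ℕ → ℝ} (h0 : a 0 = 2) (hgt : ∀ n, 1 < a n)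
    (hle : ∀ n, a n ≤ 2) (K : ℕ) :
    SquareFromTwo ↔
      (∀ n : ℕ, n < K → omegaRect ℂ 1 (a n) 1 = a n + 1 →
        omegaRect ℂ 1 (a (n + 1)) 1 = a (n + 1) + 1) ∧
      (omegaRect ℂ 1 (a K) 1 = a K + 1 → _root_.MatrixMultiplication) := by
  constructor
  · intro h
    exact ⟨fun n _ hn => saturated_of_mm (h (farTwo_of_far (hgt n).le (hle n) hn)) (hgt (n + 1)).le,
      fun hK => h (farTwo_of_far (hgt K).le (hle K) hK)⟩
  · rintro ⟨hr, hres⟩ hE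
    have hall : ∀ n, n ≤ K → omegaRect ℂ 1 (a n) 1 = a n + 1 := by
      intro n
      induction n with
      | zero => intro; rw [h0, hE]; norm_num
      | succ n ih => exact fun hn => hr n (by omega) (ih (by omega))
    exact hres (hall K le_rfl)

/-- **Price schedule, dyadic**: the hypothesis of the `K`-th truncated residual already pays
`E_{1+2^{-K}} ⟹ ω ≤ 2 + 1/(3·2^K + 1)` (`K = 0`: `9/4`; `K = 1`: `15/7`; …). [cite: Blaser2013, Theorem 5.9] -/
theorem omega_le_of_far_dyadic (K : ℕ)
    (h : omegaRect ℂ 1 (1 + 1 / 2 ^ K) 1 = (1 + 1 / 2 ^ K) + 1) :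
    omega ℂ ≤ 2 + 1 / (3 * 2 ^ K + 1) := by
  have h1 := omega_le_of_far (by positivity) h
  have e : (3 : ℝ) * ((1 + 1 / 2 ^ K) + 1) / ((1 + 1 / 2 ^ K) + 2) = 2 + 1 / (3 * 2 ^ K + 1) := by
    field_simp
    ring
  rwa [e] at h1

/-! ## §5 Junction with lens 2: one point-instance of the law per dyadic rung -/

/-- **Each dyadic rung is ONE instance of `AnchoredLogConvexity`**: the law at the single point
`m = 1 + 2^{-(n+1)}`, `e(m)² ≤ e(1)·e(2m−1)` (`2m − 1 = 1 + 2^{-n}`), gives `E_{1+2^{-n}} → E_{1+2^{-(n+1)}}`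
(lens 2's `halving_step_of_alcWindow`, window replaced by the point it uses). [cite: LottiRomani1983, §2 (p. 174)] -/
theorem dyadicRung_of_alcPoint (n : ℕ)
    (hA : (omegaRect ℂ 1 (1 + 1 / 2 ^ (n + 1)) 1 - ((1 + 1 / 2 ^ (n + 1)) + 1)) ^ 2 ≤
      (omegaRect ℂ 1 1 1 - 2) *
        (omegaRect ℂ 1 (2 * (1 + 1 / 2 ^ (n + 1)) - 1) 1 - 2 * (1 + 1 / 2 ^ (n + 1))))
    (h : omegaRect ℂ 1 (1 + 1 / 2 ^ n) 1 = (1 + 1 / 2 ^ n) + 1) :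
    omegaRect ℂ 1 (1 + 1 / 2 ^ (n + 1)) 1 = (1 + 1 / 2 ^ (n + 1)) + 1 := by
  have e : (2 : ℝ) * (1 + 1 / 2 ^ (n + 1)) - 1 = 1 + 1 / 2 ^ n := by
    rw [pow_succ]
    field_simp
    ring
  have hz : omegaRect ℂ 1 (2 * (1 + 1 / 2 ^ (n + 1)) - 1) 1 - 2 * (1 + 1 / 2 ^ (n + 1)) = 0 := by
    rw [e, h, pow_succ]
    field_simp
    ring
  rw [hz, mul_zero] at hA
  have hsq := le_antisymm hA (sq_nonneg _)
  have hlin := (pow_eq_zero_iff two_ne_zero).1 hsq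
  linarith

/-- **`SquareFromTwo` from the law at the dyadic POINTS `1 + 2^{-(n+1)}` alone** (countably many instances;
the landed `FarEdgeDescentLadderBridge.squareFromTwo_of_alcWindow` asks the window `(1, 3/2]`).
[cite: LottiRomani1983, §2 (p. 174)] -/
theorem squareFromTwo_of_alcDyadicPoints
    (hA : ∀ n : ℕ, (omegaRect ℂ 1 (1 + 1 / 2 ^ (n + 1)) 1 - ((1 + 1 / 2 ^ (n + 1)) + 1)) ^ 2 ≤
      (omegaRect ℂ 1 1 1 - 2) *
        (omegaRect ℂ 1 (2 * (1 + 1 / 2 ^ (n + 1)) - 1) 1 - 2 * (1 + 1 / 2 ^ (n + 1)))) :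
    SquareFromTwo :=
  squareFromTwo_iff_dyadicRungs.2 fun n => dyadicRung_of_alcPoint n (hA n)

/-! ## §6 One invariant decides the onset axis -/

/-- **`ω = 2 ⟺` some far-tight length exists and the onset number is `1`.**
[cite: HuangPan1998, §2 eq. (2.5)–(2.8) (p. 261–262)] -/
theorem summit_iff_onset :
    _root_.MatrixMultiplication ↔
      FiniteSaturation ∧ sInf {a : ℝ | 1 ≤ a ∧ omegaRect ℂ 1 a 1 = a + 1} = 1 := by
  constructor
  · intro h
    have hE1 : omegaRect ℂ 1 (1 : ℝ) 1 = 1 + 1 := far_one_iff.2 h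
    have hT : ∃ a : ℝ, 1 ≤ a ∧ omegaRect ℂ 1 a 1 = a + 1 := ⟨1, le_rfl, hE1⟩
    exact ⟨finiteSaturation_iff_real.2 hT,
      le_antisymm ((far_iff_sInf_le hT le_rfl).1 hE1) (far_sInf hT).1⟩
  · rintro ⟨hF, h1⟩
    have hE := (far_sInf (finiteSaturation_iff_real.1 hF)).2
    rw [h1] at hE; exact far_one_iff.1 hE

/-- **`TailDescentTwo ⟺ (FiniteSaturation → a₀ ≤ 2)`.** [cite: LottiRomani1983, §2 (p. 174)] -/
theorem tailDescentTwo_iff_onset :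
    TailDescentTwo ↔
      (FiniteSaturation → sInf {a : ℝ | 1 ≤ a ∧ omegaRect ℂ 1 a 1 = a + 1} ≤ 2) := by
  constructor
  · intro h hF
    obtain ⟨a, ha1, hE⟩ := finiteSaturation_iff_real.1 hF
    obtain ⟨k, hk⟩ := exists_nat_ge (max 3 a)
    have hk3 : (3 : ℝ) ≤ k := (le_max_left _ _).trans hk
    have h2 := h ⟨k, by exact_mod_cast hk3, far_mono (by linarith) ((le_max_right _ _).trans hk) hE⟩
    exact (far_iff_sInf_le ⟨a, ha1, hE⟩ (by norm_num)).1 (by rw [h2]; norm_num)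
  · rintro h ⟨k, hk, hEk⟩
    have hF : FiniteSaturation := ⟨k, by omega, hEk⟩
    have h2 := (far_iff_sInf_le (finiteSaturation_iff_real.1 hF) (b := 2) (by norm_num)).2 (h hF)
    rw [h2]
    norm_num

/-- **`SquareFromTwo ⟺ (FiniteSaturation → a₀ = 1 ∨ 2 < a₀)`** — the residual is the statement
`a₀ ∉ (1, 2]`. [cite: HuangPan1998, §2 eq. (2.8) (p. 262)] -/
theorem squareFromTwo_iff_onset :
    SquareFromTwo ↔
      (FiniteSaturation →
        sInf {a : ℝ | 1 ≤ a ∧ omegaRect ℂ 1 a 1 = a + 1} = 1 ∨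
          2 < sInf {a : ℝ | 1 ≤ a ∧ omegaRect ℂ 1 a 1 = a + 1}) := by
  constructor
  · intro h hF
    have hT := finiteSaturation_iff_real.1 hF
    by_contra hc
    push Not at hc
    have hE2 := (far_iff_sInf_le hT (b := 2) (by norm_num)).2 hc.2
    have hS := h (by rw [hE2]; norm_num)
    exact hc.1 (summit_iff_onset.1 hS).2
  · intro h hE
    have hF : FiniteSaturation := ⟨2, le_rfl, by push_cast; rw [hE]; norm_num⟩
    rcases h hF with h1 | h1
    · exact summit_iff_onset.2 ⟨hF, h1⟩
    · exact absurd ((far_iff_sInf_le (finiteSaturation_iff_real.1 hF) (b := 2) (by norm_num)).1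
        (by rw [hE]; norm_num)) (not_le.2 h1)

/-- **Every real rung reads `a₀ ∉ (c, b]`** (`1 ≤ c ≤ b`, some far-tight length present): so
`SquareFromTwo = [a₀ ∉ (1,2]]` and a truncated residual is `[a₀ ∉ (1,c]]`. [cite: LottiRomani1983, §1 (p. 173)] -/
theorem realRung_iff_onset (hT : ∃ a : ℝ, 1 ≤ a ∧ omegaRect ℂ 1 a 1 = a + 1) {b c : ℝ} (hc : 1 ≤ c)
    (hcb : c ≤ b) :
    (omegaRect ℂ 1 b 1 = b + 1 → omegaRect ℂ 1 c 1 = c + 1) ↔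
      ¬ (c < sInf {a : ℝ | 1 ≤ a ∧ omegaRect ℂ 1 a 1 = a + 1} ∧
          sInf {a : ℝ | 1 ≤ a ∧ omegaRect ℂ 1 a 1 = a + 1} ≤ b) := by
  rw [far_iff_sInf_le hT (hc.trans hcb), far_iff_sInf_le hT hc, not_and', not_lt]

end Summit.MatrixMultiplication.MatrixMultiplication.Theorems.SaturationLadderOnsetContinuum

end
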